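import Summits.Langlands.Langlands.Theorems.PicardMuOrdinaryMuOrdinaryFamilyRTThorneCompanionAut
import Literature.NumberTheory.GaloisRepresentations.FramedRepTwistTraceLocalProofs
import Literature.NumberTheory.GaloisRepresentations.CyclotomicCharacterArtinNorm
import HarnessLib

/-!
# Crux `MuOrdinaryFamilyRT` (stmt-Langlands-13757), line `thorne-minimal-lift`: glue G4 of
# `stub_pointAutomorphicT` — a twist by `θ` with `θ = ε^k` near `1` on inertia shifts the ordinary
# labelled weight by `-k` (`isOrdinaryOfLabelledWeightAt_twist`, PROVED under fact F9)

Let `F'` be a number field, `w ∣ 3` a finite place, `L = F'_w` (`w.adicCompletion F'`), `art` THE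
(canonically normalised) local Artin datum of `L`, `ρ : Γ_{F'} → GL₃(ℚ̄₃)` a framed representation
which is ordinary of labelled weight `λ` at `w` (`FramedGaloisRep.IsOrdinaryOfLabelledWeightAt`:
in some frame `g`, `ρ|_{Γ_L}` is upper triangular and its `i`-th diagonal entry is
`ordinaryWeightUnit λ i (Art_L⁻¹ τ)` for `τ` in an open subgroup `U` of inertia), and
`θ : Γ_{F'} → ℚ̄₃ˣ` a continuous character which agrees with `ε₃^k` on an open subgroup `U_θ` of the
inertia at `w` (e.g. an algebraic character of parallel weight `k`).  Then `ρ ⊗ θ` is ordinary at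
`w` of labelled weight `λ - k` (every `λ_{τ,j}` lowered by `k`):

* restriction to `Γ_L` commutes with the twist (`FramedGaloisRep.toLocal_twist`), and so does the
  change of frame (`FramedRep.conj_twist`, scalars are central), so in the SAME frame `g` the twist
  is `θ_L • (g ρ|_{Γ_L} g⁻¹)` entrywise (`FramedRep.coe_twist_apply`): still upper triangular, with
  `i`-th diagonal entry `θ_L(τ) · (g ρ(τ) g⁻¹)_{ii}`;
* on `U ⊓ U_θ` this is `ε₃(τ)^k · ordinaryWeightUnit λ i (Art_L⁻¹ τ)`, which is
  `ordinaryWeightUnit (λ - k) i (Art_L⁻¹ τ)` by the twist rule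
  `val_ordinaryWeightUnit_mul_cyclotomicCharacter_zpow_at` of `CyclotomicCharacterArtinNorm`
  (`ε₃ ∘ Art_L = N_{L/ℚ₃} = ∏_τ τ` on units — the named fact F9
  `cyclotomicCharacter_artin_eq_norm`, taken as a hypothesis).

This is the registered stub `isOrdinaryOfLabelledWeightAt_twist` (glue G4 of the blueprint
`thorne-minimal-lift-pointAutomorphic.md`).
-/

set_option linter.dupNamespace false -- `Summit.Langlands.Langlands.…` is the problem's namespace

namespace Summit.Langlands.Langlands.Cruxes.MuOrdinaryFamilyRT.ThorneMinimalLift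

open scoped NumberField Polynomial Matrix Classical
open Field IsDedekindDomain Polynomial
open Literature.NumberTheory.GaloisRepresentations Literature.NumberTheory.Automorphic
open Summit.Langlands.Langlands.Cruxes.MuOrdinaryFamilyRT.CharZeroDominance

noncomputable section

/-- **Twisting an ordinary representation (glue G4 of `stub_pointAutomorphicT`).**  Under fact F9
(`cyclotomicCharacter_artin_eq_norm`: `ε_ℓ ∘ Art = N` on units): if `ρ : Γ_{F'} → GL₃(ℚ̄₃)` is
ordinary of labelled weight `λ` at the place `w ∣ 3` (for THE Artin datum `art` of `F'_w`) and the
continuous character `θ : Γ_{F'} → ℚ̄₃ˣ` equals `ε₃^k` on an open subgroup of the inertia at `w`,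
then `ρ ⊗ θ` is ordinary at `w` of labelled weight `(τ, j) ↦ λ_{τ,j} - k`.  Same frame; the diagonal
entries get multiplied by `θ = ε₃^k`, and `ordinaryWeightUnit λ i u · ε₃^k = ordinaryWeightUnit
(λ - k) i u` (`val_ordinaryWeightUnit_mul_cyclotomicCharacter_zpow_at`). -/
theorem isOrdinaryOfLabelledWeightAt_twist : cyclotomicCharacter_artin_eq_norm → ∀ (F' : Type) [Field F'] [NumberField F'] (w : HeightOneSpectrum (𝓞 F')) (hw : ((3 : ℕ) : 𝓞 F') ∈ w.asIdeal) (art : LocalArtinData (w.adicCompletion F')), art.IsCanonical → ∀ (ρ : FramedGaloisRep F' (PadicAlgCl 3) 3) (wt : LabelledWeight (w.adicCompletion F') (PadicAlgCl 3) 3) (θ : absoluteGaloisGroup F' →ₜ* (PadicAlgCl 3)ˣ) (k : ℤ), ρ.IsOrdinaryOfLabelledWeightAt w art wt → (∃ U : OpenSubgroup (absoluteGaloisGroup (w.adicCompletion F')), ∀ τw ∈ WeilGroup.inertia (w.adicCompletion F'), WeilGroup.toAbsGalois (w.adicCompletion F') τw ∈ U → ((θ (absGaloisRestrict F' (w.adicCompletion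 F') (WeilGroup.toAbsGalois (w.adicCompletion F') τw)) : (PadicAlgCl 3)ˣ) : PadicAlgCl 3) = algebraMap ℤ_[3] (PadicAlgCl 3) (GaloisRep.cyclotomicCharacter (w.adicCompletion F') 3 (WeilGroup.toAbsGalois (w.adicCompletion F') τw) : ℤ_[3]) ^ k) → FramedGaloisRep.IsOrdinaryOfLabelledWeightAt w art (ρ.twist θ) (fun τ j => wt τ j - k) := by
  intro hF9 F' _ _ w hw art hart ρ wt θ k hρ hθ
  obtain ⟨g, hg, U, hU⟩ := hρ
  obtain ⟨U', hU'⟩ := hθ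
  rw [FramedGaloisRep.IsOrdinaryOfLabelledWeightAt, FramedGaloisRep.toLocal_twist]
  refine ⟨g, ?_, U ⊓ U', ?_⟩
  · -- the twist is upper triangular in the same frame
    intro σ i j hij
    rw [FramedRep.conj_twist, FramedRep.coe_twist_apply, Matrix.smul_apply, hg σ i j hij, smul_zero]
  · intro τw hτw hmem i
    rw [OpenSubgroup.mem_inf] at hmem
    have hθw : (((θ.comp (absGaloisRestrict F' (w.adicCompletion F')))
        (WeilGroup.toAbsGalois (w.adicCompletion F') τw) : (PadicAlgCl 3)ˣ) : PadicAlgCl 3) =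
        algebraMap ℤ_[3] (PadicAlgCl 3) (GaloisRep.cyclotomicCharacter (w.adicCompletion F') 3
          (WeilGroup.toAbsGalois (w.adicCompletion F') τw) : ℤ_[3]) ^ k :=
      hU' τw hτw hmem.2
    rw [FramedRep.diagEntry_apply, FramedRep.conj_twist, FramedRep.coe_twist_apply,
      Matrix.smul_apply, smul_eq_mul, ← FramedRep.diagEntry_apply, hU τw hτw hmem.1 i, hθw,
      mul_comm]
    exact val_ordinaryWeightUnit_mul_cyclotomicCharacter_zpow_at hF9 w hw hart hτw wt i k

end

end Summit.Langlands.Langlands.Cruxes.MuOrdinaryFamilyRT.ThorneMinimalLift
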